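import Literature.MathematicalPhysics.QuantumFieldTheory.Balaban1983to89.B6TreeGaugePoincare
import HarnessLib

/-!
# Crux `HistoryTailL` (stmt-QuantumFields-19936), LINE 28 candidate «gross-sd-transfer» — brick (D3♭):
# THE FLAT BOX TEST FIELD WITH CONSTANT (box-supported, tree-gauged least-squares potential of a plaquette weight)

Cell `ym3-torus` (YM ladder rung R3 = continuum SU(2) Yang–Mills on every three-torus — a RECORD rung, NOT the Clay problem), width seat
`ym-ust-19936-w5` gen 15, on the ideator's word «w5: GO (D3♭)» (ym-r3-idea-2 g15, 2026-08-29T16:22Z; idea card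
`Cruxes/HistoryTailL/Ideas/gross-sd-transfer.md`, annexes `GrossTransferAnnex1.md` §1 (C1) / `GrossTransferAnnex2.md` §3 S_test).

THE BRICK.  On the carrier of [B6] (2.123) (`B6TreeGaugePoincare`: real unit-bond configurations `Cfg d` on `ℤ^d`, the block `B(y)` of side
`L`, its inner bonds `innerBonds L y`, the comb tree `treeBonds L y` of B5 (1.7), the inner plaquettes `innerPlaq L y`, the circulation `curl`),
for every side `L ≥ 1`, corner `y` and EVERY real plaquette weight `h` (no closedness hypothesis):

* `exists_box_leastSquares_potential` — there is a configuration `u` supported on the inner bonds of `B(y)`, vanishing on the tree bonds (the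
  axial gauge (1.10)/(2.121)), whose circulation is the LEAST-SQUARES approximation of `h` on the inner plaquettes — the normal equations
  `Σ_{p ⊂ B(y)} ((∂₁u)(p) − h(p))·(∂₁A)(p) = 0` hold against EVERY configuration `A` (so `⟨∂₁u, F⟩ = ⟨h, F⟩` for every exact `F = ∂₁A` on
  the box) — with the energy bound `Σ_p (∂₁u)(p)² ≤ Σ_p h(p)²` and the POINCARÉ CONSTANT OF (2.123) BY NAME:
  `Σ_{b ⊂ B(y)} u(b)² ≤ d·L^d·Σ_{p ⊂ B(y)} h(p)²` (✓`B6TreeGaugePoincare.ineq2123`).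

This is the abelian test field of annex 1 (C1) / annex 2 S_test («box-supported coexact potential of the block-plaquette flux») with a constant;
the crude constant `d·L^d` (vs the sharp `L²`) was ACCEPTED by the line's author (it moves the depth fraction `5j < K ↦ 6j < K`, `N₁ = 6 ↦ 7`).
Supporting letters: `exists_treeGauge` (every real 1-form is a pure gradient on the comb tree Γ_y: `λ(x) := Σ_{b ∈ Γ_{y,x}} A(b)`, the
telescoping `Γ_{y,z+e_μ} = Γ_{y,z} ∪ {⟨z,z+e_μ⟩}` of ✓`B6BondElimination.contour_add_unitVec`), the private one-liner `curl_grad_eq_zero` (`∂₁∂₀ = 0`),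
`curl_congr_of_innerBonds` (the circulation around an inner plaquette reads inner bonds only), and the vector-valued (componentwise) corollary
`exists_box_leastSquares_potential_pi`.

WHAT THIS IS NOT.  Pure finite-dimensional linear algebra (orthogonal projection onto the range of `∂₁` restricted to tree-gauged box fields) over
a landed Poincaré inequality; NOT the covariant statement `h̃ = D_U u + r` in a small background (annex 1 D3), NOT the Schwinger–Dyson step, NOT any
tail or moment bound; LINE 28 is an idea card, not a registered line; nothing of (Q), «ShallowFluxSecondMomentL», `MeanDeviationL`, `HistoryTailL`
or the rung is proved.  YM₃ on T³ is rung R3 — NOT d = 4, NOT infinite volume, NOT a mass gap, NOT the Clay problem.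

References: T. Bałaban, CMP **96** (1984) 223–250 [Balaban1984PropagatorsII] ((2.121), (2.123) p.244); CMP **95** (1984) 17–40
[Balaban1984PropagatorsI] ((1.6), (1.7), (1.10) pp.18–19); L. Gross, CMP **92** (1983) 137–162 [GrossCMP1983] (Thm 2.2: the abelian test field).
-/

noncomputable section

open Finset
open scoped RealInnerProductSpace
open Literature.MathematicalPhysics.QuantumFieldTheory.Balaban1983to89
open Literature.MathematicalPhysics.QuantumFieldTheory.Balaban1983to89.B6TreeGaugePoincare
  (Cfg curl innerBonds innerPlaq mem_innerBonds mem_innerBonds_iff mem_innerPlaq_iff ineq2123 treeBonds_subset_innerBonds)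
open Literature.MathematicalPhysics.QuantumFieldTheory.Balaban1983to89.B6Elimination (block mem_block)
open Literature.MathematicalPhysics.QuantumFieldTheory.Balaban1983to89.B6BondElimination
  (unitVec unitVec_apply add_unitVec_apply treeBonds mem_treeBonds contour mem_contour contour_add_unitVec not_mem_contour
    add_unitVec_mem_block)

namespace Summit.QuantumFields.YangMills.Theorems

namespace UnitScaleGibbsBoxLeastSquaresPotential

variable {d : ℕ} {L : ℕ}

/-! ## §1  Letters: linearity of the circulation, `∂₁∂₀ = 0`, locality, the abelian tree gauge -/

/-- The circulation is additive in the configuration (private: the same one-liner is landed elsewhere in the tree, e.g.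
`BJ86AxialSubspace212.curl_add`; kept local to avoid a heavy import). [folklore] -/
private theorem curl_add (A B : Cfg d) (z : Fin d → ℤ) (j μ : Fin d) :
    curl (A + B) z j μ = curl A z j μ + curl B z j μ := by
  simp only [curl, Pi.add_apply]
  ring

/-- The circulation of a difference. [folklore] -/
theorem curl_sub (A B : Cfg d) (z : Fin d → ℤ) (j μ : Fin d) :
    curl (A - B) z j μ = curl A z j μ - curl B z j μ := by
  simp only [curl, Pi.sub_apply]
  ring

/-- The circulation is homogeneous in the configuration. [folklore] -/
theorem curl_smul (c : ℝ) (A : Cfg d) (z : Fin d → ℤ) (j μ : Fin d) :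
    curl (c • A) z j μ = c * curl A z j μ := by
  simp only [curl, Pi.smul_apply, smul_eq_mul]
  ring

/-- `∂₁∂₀ = 0`: the circulation of a pure gradient `b ↦ λ(b⁺) − λ(b⁻)` vanishes around every plaquette (private: the same one-liner is
landed as `N21ChartExponentCoercivity.curl_grad_eq_zero`; kept local to avoid importing the N21 chain). [folklore] -/
private theorem curl_grad_eq_zero (f : (Fin d → ℤ) → ℝ) (z : Fin d → ℤ) (j μ : Fin d) :
    curl (fun b : (Fin d → ℤ) × Fin d => f (b.1 + unitVec b.2) - f b.1) z j μ = 0 := by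
  simp only [curl]
  rw [add_right_comm z (unitVec μ) (unitVec j)]
  ring

/-- The four bonds of an inner plaquette of `B(y)` are inner bonds of `B(y)`. [cite: Balaban1984PropagatorsII, (2.123) p.244] -/
theorem bonds_mem_innerBonds_of_mem_innerPlaq {y z : Fin d → ℤ} {j μ : Fin d} (hp : (z, j, μ) ∈ innerPlaq L y) :
    (z, j) ∈ innerBonds L y ∧ (z + unitVec j, μ) ∈ innerBonds L y ∧ (z + unitVec μ, j) ∈ innerBonds L y ∧
      (z, μ) ∈ innerBonds L y := by
  obtain ⟨-, hz, hzj, hzμ, hzjμ⟩ := mem_innerPlaq_iff.1 hp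
  refine ⟨mem_innerBonds_iff.2 ⟨hz, hzj⟩, mem_innerBonds_iff.2 ⟨hzj, hzjμ⟩, mem_innerBonds_iff.2 ⟨hzμ, ?_⟩,
    mem_innerBonds_iff.2 ⟨hz, hzμ⟩⟩
  simpa [add_right_comm z (unitVec μ) (unitVec j)] using hzjμ

/-- LOCALITY: the circulation around an inner plaquette of `B(y)` reads the configuration on inner bonds of `B(y)` only. [folklore] -/
theorem curl_congr_of_innerBonds {y : Fin d → ℤ} {A B : Cfg d} (hAB : ∀ b ∈ innerBonds L y, A b = B b)
    {z : Fin d → ℤ} {j μ : Fin d} (hp : (z, j, μ) ∈ innerPlaq L y) : curl A z j μ = curl B z j μ := by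
  obtain ⟨h1, h2, h3, h4⟩ := bonds_mem_innerBonds_of_mem_innerPlaq hp
  simp only [curl, hAB _ h1, hAB _ h2, hAB _ h3, hAB _ h4]

/-- **THE ABELIAN TREE GAUGE EXISTS.**  Every real configuration `A` is a pure gradient on the comb tree `Γ_y` of `B(y)`: with
`λ(x) := Σ_{b ∈ Γ_{y,x}} A(b)` (the contour integral of B5 (1.7)), `A⟨z, z+e_μ⟩ = λ(z+e_μ) − λ(z)` for every tree bond — the telescoping
`Γ_{y,z+e_μ} = Γ_{y,z} ∪ {⟨z, z+e_μ⟩}`.  Hence `A − ∂₀λ` satisfies the axial gauge (1.10)/(2.121). [cite: Balaban1984PropagatorsI, (1.7) and (1.10) pp.18-19] -/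
theorem exists_treeGauge (y : Fin d → ℤ) (A : Cfg d) :
    ∃ f : (Fin d → ℤ) → ℝ, ∀ b ∈ treeBonds L y, A b = f (b.1 + unitVec b.2) - f b.1 := by
  refine ⟨fun x => ∑ b ∈ contour L y x, A b, fun b hb => ?_⟩
  obtain ⟨hz, h1, -⟩ := mem_treeBonds.1 hb
  simp only
  rw [contour_add_unitVec hz h1, sum_insert (not_mem_contour y b.1 b.2), Prod.mk.eta]
  ring

/-! ## §2  The box least-squares potential -/

/-- **(D3♭) THE FLAT BOX TEST FIELD WITH CONSTANT.**  For every side `L ≥ 1`, corner `y` and every real plaquette weight `h` there is a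
configuration `u` with: (i) `u` is supported on the inner bonds of `B(y)`; (ii) `u` vanishes on the tree bonds (axial gauge (2.121)); (iii) the
NORMAL EQUATIONS `Σ_{p ⊂ B(y)} ((∂₁u)(p) − h(p))·(∂₁A)(p) = 0` against EVERY configuration `A` (least squares: `∂₁u` is the orthogonal projection
of `h` onto the circulations of box fields, which the tree-gauged ones exhaust by `exists_treeGauge` and `∂₁∂₀ = 0`); (iv) the energy bound
`Σ_p (∂₁u)(p)² ≤ Σ_p h(p)²`; (v) the Poincaré bound `Σ_{b ⊂ B(y)} u(b)² ≤ d·L^d·Σ_{p ⊂ B(y)} h(p)²` — (2.123) BY NAME on the tree-gauged `u`, then (iv).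
[cite: Balaban1984PropagatorsII, (2.121) and (2.123) p.244; GrossCMP1983, Thm 2.2] -/
theorem exists_box_leastSquares_potential (hL : 1 ≤ L) (y : Fin d → ℤ) (h : (Fin d → ℤ) × Fin d × Fin d → ℝ) :
    ∃ u : Cfg d,
      (∀ b, b ∉ innerBonds L y → u b = 0) ∧
      (∀ b ∈ treeBonds L y, u b = 0) ∧
      (∀ A : Cfg d, ∑ p ∈ innerPlaq L y, (curl u p.1 p.2.1 p.2.2 - h p) * curl A p.1 p.2.1 p.2.2 = 0) ∧
      ∑ p ∈ innerPlaq L y, curl u p.1 p.2.1 p.2.2 ^ 2 ≤ ∑ p ∈ innerPlaq L y, h p ^ 2 ∧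
      ∑ b ∈ innerBonds L y, u b ^ 2 ≤ (d : ℝ) * (L : ℝ) ^ d * ∑ p ∈ innerPlaq L y, h p ^ 2 := by
  classical
  -- the free bonds (inner, off the tree) and the inner plaquettes as finite index types
  set S : Finset ((Fin d → ℤ) × Fin d) := innerBonds L y \ treeBonds L y with hS_def
  -- extension by zero of a free-bond vector to a configuration
  let ext : EuclideanSpace ℝ S → Cfg d := fun v b => if hb : b ∈ S then v ⟨b, hb⟩ else 0
  have ext_add : ∀ v w, ext (v + w) = ext v + ext w := by
    intro v w
    funext b
    by_cases hb : b ∈ S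
    · simp only [ext, dif_pos hb, Pi.add_apply, PiLp.add_apply]
    · simp only [ext, dif_neg hb, Pi.add_apply, add_zero]
  have ext_smul : ∀ (c : ℝ) v, ext (c • v) = c • ext v := by
    intro c v
    funext b
    by_cases hb : b ∈ S
    · simp only [ext, dif_pos hb, Pi.smul_apply, PiLp.smul_apply, smul_eq_mul]
    · simp only [ext, dif_neg hb, Pi.smul_apply, smul_eq_mul, mul_zero]
  have ext_off : ∀ v b, b ∉ innerBonds L y → ext v b = 0 := by
    intro v b hb
    have : b ∉ S := fun hbS => hb (mem_sdiff.1 hbS).1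
    simp only [ext, dif_neg this]
  have ext_tree : ∀ v, ∀ b ∈ treeBonds L y, ext v b = 0 := by
    intro v b hb
    have : b ∉ S := fun hbS => (mem_sdiff.1 hbS).2 hb
    simp only [ext, dif_neg this]
  -- the circulation map on the inner plaquettes
  let T : EuclideanSpace ℝ S →ₗ[ℝ] EuclideanSpace ℝ (innerPlaq L y) :=
    { toFun := fun v => WithLp.toLp 2 fun p => curl (ext v) p.1.1 p.1.2.1 p.1.2.2
      map_add' := by
        intro v w
        ext p
        simp only [ext_add, curl_add, PiLp.add_apply]
      map_smul' := by
        intro c v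
        ext p
        simp only [ext_smul, curl_smul, PiLp.smul_apply, smul_eq_mul, RingHom.id_apply] }
  have T_apply : ∀ v (p : innerPlaq L y), T v p = curl (ext v) p.1.1 p.1.2.1 p.1.2.2 := fun v p => rfl
  -- the datum as a Euclidean vector and its orthogonal projection onto the range of `T`
  let hE : EuclideanSpace ℝ (innerPlaq L y) := WithLp.toLp 2 fun p => h p.1
  have hE_apply : ∀ p : innerPlaq L y, hE p = h p.1 := fun p => rfl
  let K : Submodule ℝ (EuclideanSpace ℝ (innerPlaq L y)) := LinearMap.range T
  haveI : CompleteSpace K := FiniteDimensional.complete ℝ K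
  obtain ⟨v, hv⟩ := LinearMap.mem_range.1 (K.starProjection_apply_mem hE)
  have horth : ∀ v', ⟪hE - T v, T v'⟫ = 0 := by
    intro v'
    have hm := K.sub_starProjection_mem_orthogonal hE
    rw [← hv] at hm
    exact (Submodule.mem_orthogonal' _ _).1 hm _ (LinearMap.mem_range_self T v')
  have hnorm : ‖T v‖ ≤ ‖hE‖ := by
    rw [hv]
    exact K.norm_starProjection_apply_le hE
  -- Euclidean inner products and norms as sums over the inner plaquettes
  have inner_eq : ∀ x z : EuclideanSpace ℝ (innerPlaq L y), ⟪x, z⟫ = ∑ p : innerPlaq L y, x p * z p := by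
    intro x z
    rw [PiLp.inner_apply]
    exact sum_congr rfl fun p _ => by simp [mul_comm]
  have norm_sq_eq : ∀ x : EuclideanSpace ℝ (innerPlaq L y), ‖x‖ ^ 2 = ∑ p : innerPlaq L y, x p ^ 2 := by
    intro x
    rw [EuclideanSpace.norm_eq, Real.sq_sqrt (sum_nonneg fun p _ => by positivity)]
    exact sum_congr rfl fun p _ => by rw [Real.norm_eq_abs, sq_abs]
  refine ⟨ext v, ext_off v, ext_tree v, fun A => ?_, ?_, ?_⟩
  · -- (iii) normal equations against an arbitrary `A`: tree-gauge `A`, which does not change its circulation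
    obtain ⟨f, hf⟩ := exists_treeGauge (L := L) y A
    set A' : Cfg d := A - fun b => f (b.1 + unitVec b.2) - f b.1 with hA'_def
    have hA'curl : ∀ z j μ, curl A' z j μ = curl A z j μ := by
      intro z j μ
      rw [hA'_def, curl_sub, curl_grad_eq_zero, sub_zero]
    have hA'tree : ∀ b ∈ treeBonds L y, A' b = 0 := by
      intro b hb
      rw [hA'_def, Pi.sub_apply, hf b hb, sub_self]
    let v' : EuclideanSpace ℝ S := WithLp.toLp 2 fun b => A' b.1
    have hext' : ∀ b ∈ innerBonds L y, ext v' b = A' b := by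
      intro b hb
      by_cases hbt : b ∈ treeBonds L y
      · rw [ext_tree v' b hbt, hA'tree b hbt]
      · have hbS : b ∈ S := mem_sdiff.2 ⟨hb, hbt⟩
        simp only [ext, dif_pos hbS]
        rfl
    have hcurl' : ∀ p ∈ innerPlaq L y, curl (ext v') p.1 p.2.1 p.2.2 = curl A p.1 p.2.1 p.2.2 := by
      rintro ⟨z, j, μ⟩ hp
      rw [curl_congr_of_innerBonds hext' hp, hA'curl]
    have h0 := horth v'
    rw [inner_eq] at h0
    rw [← sum_coe_sort (innerPlaq L y)]
    have : ∑ p : innerPlaq L y, (curl (ext v) p.1.1 p.1.2.1 p.1.2.2 - h p.1) * curl A p.1.1 p.1.2.1 p.1.2.2 =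
        -∑ p : innerPlaq L y, (hE - T v) p * T v' p := by
      rw [← sum_neg_distrib]
      refine sum_congr rfl fun p _ => ?_
      rw [PiLp.sub_apply, hE_apply, T_apply, T_apply, hcurl' p.1 p.2]
      ring
    rw [this, h0, neg_zero]
  · -- (iv) energy bound: the projection is a contraction
    have h1 : ∑ p ∈ innerPlaq L y, curl (ext v) p.1 p.2.1 p.2.2 ^ 2 = ‖T v‖ ^ 2 := by
      rw [norm_sq_eq, ← sum_coe_sort (innerPlaq L y)]
      exact sum_congr rfl fun p _ => by rw [T_apply]
    have h2 : ∑ p ∈ innerPlaq L y, h p ^ 2 = ‖hE‖ ^ 2 := by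
      rw [norm_sq_eq, ← sum_coe_sort (innerPlaq L y)]
    rw [h1, h2]
    exact pow_le_pow_left₀ (norm_nonneg _) hnorm 2
  · -- (v) Poincaré: (2.123) on the tree-gauged `ext v`, then (iv)
    have h1 : ∑ p ∈ innerPlaq L y, curl (ext v) p.1 p.2.1 p.2.2 ^ 2 = ‖T v‖ ^ 2 := by
      rw [norm_sq_eq, ← sum_coe_sort (innerPlaq L y)]
      exact sum_congr rfl fun p _ => by rw [T_apply]
    have h2 : ∑ p ∈ innerPlaq L y, h p ^ 2 = ‖hE‖ ^ 2 := by
      rw [norm_sq_eq, ← sum_coe_sort (innerPlaq L y)]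
    have hP := ineq2123 hL y (ext v) (ext_tree v)
    refine hP.trans (mul_le_mul_of_nonneg_left ?_ (by positivity))
    rw [h1, h2]
    exact pow_le_pow_left₀ (norm_nonneg _) hnorm 2

/-- **Componentwise (vector-valued) form** of `exists_box_leastSquares_potential`: for a weight with values in `Fin m → ℝ` (e.g. `𝔰𝔲(2) ≅ ℝ³`
in a fixed frame) one potential per component, each box-supported, tree-gauged, solving its normal equations, with the energy and (2.123) bounds.
[cite: Balaban1984PropagatorsII, (2.123) p.244] -/
theorem exists_box_leastSquares_potential_pi (hL : 1 ≤ L) (y : Fin d → ℤ) {m : ℕ}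
    (h : (Fin d → ℤ) × Fin d × Fin d → Fin m → ℝ) :
    ∃ u : Fin m → Cfg d, ∀ k : Fin m,
      (∀ b, b ∉ innerBonds L y → u k b = 0) ∧
      (∀ b ∈ treeBonds L y, u k b = 0) ∧
      (∀ A : Cfg d, ∑ p ∈ innerPlaq L y, (curl (u k) p.1 p.2.1 p.2.2 - h p k) * curl A p.1 p.2.1 p.2.2 = 0) ∧
      ∑ p ∈ innerPlaq L y, curl (u k) p.1 p.2.1 p.2.2 ^ 2 ≤ ∑ p ∈ innerPlaq L y, h p k ^ 2 ∧
      ∑ b ∈ innerBonds L y, u k b ^ 2 ≤ (d : ℝ) * (L : ℝ) ^ d * ∑ p ∈ innerPlaq L y, h p k ^ 2 := by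
  have hk := fun k : Fin m => exists_box_leastSquares_potential hL y fun p => h p k
  exact ⟨fun k => (hk k).choose, fun k => (hk k).choose_spec⟩

/-! ## §3  The bond count and the ℓ¹ bound (annex 4 §6 `stub_test`: «‖u⁰‖₁ explicit») -/

/-- The block `B(y)` has at most `d·L^d` inner bonds (`L^d` starting points, `d` directions). [cite: Balaban1984PropagatorsI, (1.6) p.18] -/
theorem card_innerBonds_le (y : Fin d → ℤ) : ((innerBonds L y).card : ℝ) ≤ (d : ℝ) * (L : ℝ) ^ d := by
  classical
  have h1 : (innerBonds L y).card ≤ (block L y ×ˢ (univ : Finset (Fin d))).card := card_filter_le _ _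
  rw [card_product, B6Elimination.card_block, card_univ, Fintype.card_fin] at h1
  have h2 : ((innerBonds L y).card : ℝ) ≤ ((L ^ d * d : ℕ) : ℝ) := by exact_mod_cast h1
  calc ((innerBonds L y).card : ℝ) ≤ ((L ^ d * d : ℕ) : ℝ) := h2
    _ = (d : ℝ) * (L : ℝ) ^ d := by push_cast; ring

/-- `ℓ¹ ≤ √(card)·ℓ²` on the inner bonds, in the squared-budget form used below: if `Σ_b u_b² ≤ M·S` with `#bonds ≤ M` then
`Σ_b |u_b| ≤ M·√S`. [folklore] -/
theorem sum_abs_le_of_sum_sq_le {y : Fin d → ℤ} {u : Cfg d} {M S : ℝ} (hM : ((innerBonds L y).card : ℝ) ≤ M) (hS : 0 ≤ S)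
    (hu : ∑ b ∈ innerBonds L y, u b ^ 2 ≤ M * S) :
    ∑ b ∈ innerBonds L y, |u b| ≤ M * Real.sqrt S := by
  have hM0 : 0 ≤ M := le_trans (Nat.cast_nonneg _) hM
  have hcs : (∑ b ∈ innerBonds L y, |u b|) ^ 2 ≤ (innerBonds L y).card * ∑ b ∈ innerBonds L y, |u b| ^ 2 :=
    sq_sum_le_card_mul_sum_sq
  have habs : ∑ b ∈ innerBonds L y, |u b| ^ 2 = ∑ b ∈ innerBonds L y, u b ^ 2 :=
    sum_congr rfl fun b _ => sq_abs (u b)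
  rw [habs] at hcs
  have h2 : (∑ b ∈ innerBonds L y, |u b|) ^ 2 ≤ (M * Real.sqrt S) ^ 2 := by
    calc (∑ b ∈ innerBonds L y, |u b|) ^ 2 ≤ (innerBonds L y).card * ∑ b ∈ innerBonds L y, u b ^ 2 := hcs
      _ ≤ M * (M * S) := mul_le_mul hM hu (sum_nonneg fun b _ => sq_nonneg _) hM0
      _ = (M * Real.sqrt S) ^ 2 := by rw [mul_pow, Real.sq_sqrt hS]; ring
  exact pow_le_pow_iff_left₀ (sum_nonneg fun b _ => abs_nonneg _) (mul_nonneg hM0 (Real.sqrt_nonneg S))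
    two_ne_zero |>.1 h2

/-- **(D3♭) WITH THE ℓ¹ BUDGET** — the form annex 4 §6 `stub_test` asks for («u⁰ off-tree, `∂₁u⁰` = LS-projection of `h`, `‖u⁰‖₂² ≤ d·n^d·‖h‖₂²`,
`‖u⁰‖₁` explicit»): the five conjuncts of `exists_box_leastSquares_potential` and (vi) `Σ_{b ⊂ B(y)} |u(b)| ≤ d·L^d·√(Σ_{p ⊂ B(y)} h(p)²)`
(`#bonds ≤ d·L^d` times Cauchy–Schwarz; in d = 3 with `n = 17·L^j`: `‖u⁰‖₁ ≤ 3n³·‖h‖₂`). [cite: Balaban1984PropagatorsII, (2.123) p.244; GrossCMP1983, Thm 2.2] -/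
theorem exists_box_leastSquares_potential_l1 (hL : 1 ≤ L) (y : Fin d → ℤ) (h : (Fin d → ℤ) × Fin d × Fin d → ℝ) :
    ∃ u : Cfg d,
      (∀ b, b ∉ innerBonds L y → u b = 0) ∧
      (∀ b ∈ treeBonds L y, u b = 0) ∧
      (∀ A : Cfg d, ∑ p ∈ innerPlaq L y, (curl u p.1 p.2.1 p.2.2 - h p) * curl A p.1 p.2.1 p.2.2 = 0) ∧
      ∑ p ∈ innerPlaq L y, curl u p.1 p.2.1 p.2.2 ^ 2 ≤ ∑ p ∈ innerPlaq L y, h p ^ 2 ∧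
      ∑ b ∈ innerBonds L y, u b ^ 2 ≤ (d : ℝ) * (L : ℝ) ^ d * ∑ p ∈ innerPlaq L y, h p ^ 2 ∧
      ∑ b ∈ innerBonds L y, |u b| ≤ (d : ℝ) * (L : ℝ) ^ d * Real.sqrt (∑ p ∈ innerPlaq L y, h p ^ 2) := by
  obtain ⟨u, h1, h2, h3, h4, h5⟩ := exists_box_leastSquares_potential hL y h
  exact ⟨u, h1, h2, h3, h4, h5,
    sum_abs_le_of_sum_sq_le (card_innerBonds_le y) (sum_nonneg fun p _ => sq_nonneg _) h5⟩

end UnitScaleGibbsBoxLeastSquaresPotential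

end Summit.QuantumFields.YangMills.Theorems

end
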